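import Mathlib
import Summits.Ventures.PercRepro.TriangleCapFiveRowFourCapMain
import Summits.Ventures.PercRepro.TriangleCapThirdOrderThirteen
import Summits.Ventures.PercRepro.TriangleCapFiveRowThree

/-!
# PercRepro — THE PIECES OF THE ROW `a = 5` AT `r = 4`: the side lemma of a deletion onto a `5`-bipartite `D − z`
and the arithmetic of the six deletions (p3, gen 46; part 199w)

For part 199x on the cell `(k, 5, 4)` (`k ≥ 14`; target `Σ_v d(v)² + 4 (k − 5) + 4 ≤ m k`, the bipartite second-best
gap of the brooms): a vertex `z` of degree `d ≤ 5` is deleted and `D − z` read on the cell `(k − 1, 5, d − 1)`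
(`d ≥ 1`) or `(k − 1, 6, k − 13)` (`d = 0`). Whenever `D − z` is `5`-bipartite with the `5`-side `A'`
(`five_four_sides`): the neighbours of `z` all in `A'` make `D` `5`-bipartite, all off `A'` make `D` `6`-bipartite
with `k − 7` missing pairs, whose closed form `6 (k − 7) ≥ 4 (k − 5) + 4` (`k ≥ 13`), and otherwise a neighbour off
`A'` has degree `≤ 5` in `D − z`, so `T ≤ (d − 1)(k − 7) + 5`. Axioms: standard.
-/

namespace PercRepro

namespace TriangleCap

namespace C047

open Finset

variable {V : Type*} [Fintype V] [DecidableEq V]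

/-- **THE SIDES OF A `5`-BIPARTITE `D − z` ON THE CELL `(k, 5, 4)`:** `D` is `5`-bipartite, or below the target, or a
neighbour of `z` lies off the `5`-side and `T + (k − 7) ≤ d(z) (k − 7) + 5`. -/
theorem five_four_sides (D : SimpleGraph V) [DecidableRel D.Adj] (hk : 14 ≤ Fintype.card V)
    (hm : D.edgeFinset.card + 4 = 5 * (Fintype.card V - 5)) (z : V) (A' : Finset {v : V // v ≠ z})
    (hA'card : A'.card = 5) (hB : BipSub (del D z) A') (hcap7 : ∀ v, deg D v ≤ (Fintype.card V - 7) + 1) :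
    (∃ A : Finset V, A.card = 5 ∧ BipSub D A) ∨
      (∑ v, deg D v * deg D v + 4 * (Fintype.card V - 5) + 4 ≤ D.edgeFinset.card * Fintype.card V) ∨
      (∑ a : {v : V // v ≠ z}, (if D.Adj a.1 z then deg (del D z) a else 0) + (Fintype.card V - 7) ≤
        deg D z * (Fintype.card V - 7) + 5) := by
  by_cases hall : ∀ a : {v : V // v ≠ z}, D.Adj a.1 z → a ∈ A'
  · obtain ⟨B, hBcard, hBsub⟩ := bipSub_lift D z A' hB hall
    exact Or.inl ⟨B, by rw [hBcard, hA'card], hBsub⟩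
  by_cases hnone : ∀ a : {v : V // v ≠ z}, D.Adj a.1 z → a ∉ A'
  · right; left
    obtain ⟨A, hAcard, hAsub⟩ := bipSub_insert_of_nbhd_off D z A' hB hnone
    rw [hA'card] at hAcard
    have h := sum_deg_sq_le_of_bipSub D A hAsub 6 (Fintype.card V - 7) hAcard (by omega) (by omega)
    have e : Fintype.card V - 1 - (Fintype.card V - 7) = 6 := by omega
    rw [e] at h
    omega
  · right; right
    push Not at hall
    obtain ⟨w₀, hw₀z, hw₀A⟩ := hall
    obtain ⟨Nz, hNzdef⟩ : ∃ Nz : Finset {v : V // v ≠ z},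
        Nz = univ.filter (fun a : {v : V // v ≠ z} => D.Adj a.1 z) := ⟨_, rfl⟩
    have hmemNz : ∀ a : {v : V // v ≠ z}, a ∈ Nz ↔ D.Adj a.1 z := fun a => by
      rw [hNzdef, mem_filter]
      simp only [mem_univ, true_and]
    have hNz : Nz.card = deg D z := by rw [hNzdef]; exact card_nbhd_del D z
    have hTfilt : ∑ a : {v : V // v ≠ z}, (if D.Adj a.1 z then deg (del D z) a else 0) =
        ∑ a ∈ Nz, deg (del D z) a := by
      rw [hNzdef, sum_filter]
    rw [hTfilt, ← hNz]
    have hdw₀ : deg (del D z) w₀ ≤ 5 := by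
      have := deg_le_card_of_bipSub (del D z) A' hB w₀ hw₀A
      rw [hA'card] at this
      exact this
    exact sum_le_of_mem_le_gen Nz (fun a => deg (del D z) a) (Fintype.card V - 7) 5 ((hmemNz w₀).mpr hw₀z)
      (fun a ha => by
        have h := deg_del D z a
        rw [if_pos ((hmemNz a).mp ha)] at h
        have := hcap7 a.1
        omega) hdw₀

/-- `d = 0`: `D − z` on `(k − 1, 6, k − 13)`: `S' + 11 (k − 13) ≤ m (k − 1)`. -/
theorem five_four_del_zero_arith (s m' S' T : ℕ) (hm' : m' = 5 * s + 41)
    (hS' : S' + (s + 14 - 13) * 11 ≤ m' * (s + 13)) (hT : T ≤ 0 * (s + 14 - 7)) :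
    S' + 2 * T + 0 + 0 * 0 + 4 * (s + 14 - 5) + 4 ≤ (m' + 0) * (s + 14) := by
  subst hm'
  have e1 : s + 14 - 13 = s + 1 := by omega
  have e2 : s + 14 - 5 = s + 9 := by omega
  rw [e1] at hS'
  rw [e2]
  have hT0 : T = 0 := by omega
  subst hT0
  nlinarith [hS']

/-- `d = 1`, `D − z` not `5`-bipartite on the diagonal `(k − 1, 5, 0)`: `S' + 10 (k − 12) ≤ m' (k − 1)`, `T ≤ k − 7`. -/
theorem five_four_del_one_gap_arith (s m' S' T : ℕ) (hm' : m' = 5 * s + 40)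
    (hS' : S' + 2 * 5 * (s + 13 - 2 * 5 - 1) ≤ m' * (s + 13)) (hT : T ≤ 1 * (s + 14 - 7)) :
    S' + 2 * T + 1 + 1 * 1 + 4 * (s + 14 - 5) + 4 ≤ (m' + 1) * (s + 14) := by
  subst hm'
  have e1 : s + 13 - 2 * 5 - 1 = s + 2 := by omega
  have e2 : s + 14 - 5 = s + 9 := by omega
  have e4 : s + 14 - 7 = s + 7 := by omega
  rw [e1] at hS'
  rw [e4] at hT
  rw [e2]
  nlinarith [hS', hT]

/-- `d = 2`, mixed onto `(k − 1, 5, 1)`: `S' + (k − 3) ≤ m' (k − 1)`, `T + (k − 7) ≤ 2 (k − 7) + 5`. -/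
theorem five_four_del_two_mixed_arith (s m' S' T : ℕ) (hm' : m' = 5 * s + 39)
    (hS' : S' + 1 * (s + 13 - 1 - 1) ≤ m' * (s + 13)) (hT : T + (s + 14 - 7) ≤ 2 * (s + 14 - 7) + 5) :
    S' + 2 * T + 2 + 2 * 2 + 4 * (s + 14 - 5) + 4 ≤ (m' + 2) * (s + 14) := by
  subst hm'
  have e1 : s + 13 - 1 - 1 = s + 11 := by omega
  have e2 : s + 14 - 5 = s + 9 := by omega
  have e4 : s + 14 - 7 = s + 7 := by omega
  rw [e1] at hS'
  rw [e4] at hT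
  rw [e2]
  nlinarith [hS', hT]

/-- `d = 2`, `D − z` not `5`-bipartite on `(k − 1, 5, 1)`: `S' + (k − 3) + 8 (k − 12) ≤ m' (k − 1)`, `T ≤ 2 (k − 7)`. -/
theorem five_four_del_two_gap_arith (s m' S' T : ℕ) (hm' : m' = 5 * s + 39)
    (hS' : S' + (s + 13 - 2) + 2 * (s + 13 - 2 * 5 - 1) * (5 - 1) ≤ m' * (s + 13)) (hT : T ≤ 2 * (s + 14 - 7)) :
    S' + 2 * T + 2 + 2 * 2 + 4 * (s + 14 - 5) + 4 ≤ (m' + 2) * (s + 14) := by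
  subst hm'
  have e0 : s + 13 - 2 = s + 11 := by omega
  have e1 : s + 13 - 2 * 5 - 1 = s + 2 := by omega
  have e2 : s + 14 - 5 = s + 9 := by omega
  have e4 : s + 14 - 7 = s + 7 := by omega
  rw [e0, e1] at hS'
  rw [e4] at hT
  rw [e2]
  nlinarith [hS', hT]

/-- `d = 3`, mixed onto `(k − 1, 5, 2)`: `S' + 2 (k − 4) ≤ m' (k − 1)`, `T + (k − 7) ≤ 3 (k − 7) + 5`. -/
theorem five_four_del_three_mixed_arith (s m' S' T : ℕ) (hm' : m' = 5 * s + 38)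
    (hS' : S' + 2 * (s + 13 - 1 - 2) ≤ m' * (s + 13)) (hT : T + (s + 14 - 7) ≤ 3 * (s + 14 - 7) + 5) :
    S' + 2 * T + 3 + 3 * 3 + 4 * (s + 14 - 5) + 4 ≤ (m' + 3) * (s + 14) := by
  subst hm'
  have e1 : s + 13 - 1 - 2 = s + 10 := by omega
  have e2 : s + 14 - 5 = s + 9 := by omega
  have e4 : s + 14 - 7 = s + 7 := by omega
  rw [e1] at hS'
  rw [e4] at hT
  rw [e2]
  nlinarith [hS', hT]

/-- `d = 3`, `D − z` not `5`-bipartite on `(k − 1, 5, 2)`: `S' + 2 (k − 4) + 6 (k − 12) ≤ m' (k − 1)`,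
`T ≤ 3 (k − 7)`. -/
theorem five_four_del_three_gap_arith (s m' S' T : ℕ) (hm' : m' = 5 * s + 38)
    (hS' : S' + 2 * (s + 13 - 1 - 2) + 2 * (s + 13 - 2 * 5 - 1) * (5 - 2) ≤ m' * (s + 13))
    (hT : T ≤ 3 * (s + 14 - 7)) :
    S' + 2 * T + 3 + 3 * 3 + 4 * (s + 14 - 5) + 4 ≤ (m' + 3) * (s + 14) := by
  subst hm'
  have e0 : s + 13 - 1 - 2 = s + 10 := by omega
  have e1 : s + 13 - 2 * 5 - 1 = s + 2 := by omega
  have e2 : s + 14 - 5 = s + 9 := by omega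
  have e4 : s + 14 - 7 = s + 7 := by omega
  rw [e0, e1] at hS'
  rw [e4] at hT
  rw [e2]
  nlinarith [hS', hT]

/-- `d = 4`, mixed onto `(k − 1, 5, 3)`: `S' + 3 (k − 5) ≤ m' (k − 1)`, `T + (k − 7) ≤ 4 (k − 7) + 5`. -/
theorem five_four_del_four_mixed_arith (s m' S' T : ℕ) (hm' : m' = 5 * s + 37)
    (hS' : S' + 3 * (s + 13 - 1 - 3) ≤ m' * (s + 13)) (hT : T + (s + 14 - 7) ≤ 4 * (s + 14 - 7) + 5) :
    S' + 2 * T + 4 + 4 * 4 + 4 * (s + 14 - 5) + 4 ≤ (m' + 4) * (s + 14) := by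
  subst hm'
  have e1 : s + 13 - 1 - 3 = s + 9 := by omega
  have e2 : s + 14 - 5 = s + 9 := by omega
  have e4 : s + 14 - 7 = s + 7 := by omega
  rw [e1] at hS'
  rw [e4] at hT
  rw [e2]
  nlinarith [hS', hT]

/-- `d = 4`, `D − z` not `5`-bipartite on `(k − 1, 5, 3)`: `S' + 3 (k − 5) + (2k − 24) ≤ m' (k − 1)`, `T ≤ 4 (k − 7)`. -/
theorem five_four_del_four_gap_arith (s m' S' T : ℕ) (hm' : m' = 5 * s + 37)
    (hS' : S' + 3 * (s + 13 - 4) + (2 * (s + 13) - 22) ≤ m' * (s + 13)) (hT : T ≤ 4 * (s + 14 - 7)) :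
    S' + 2 * T + 4 + 4 * 4 + 4 * (s + 14 - 5) + 4 ≤ (m' + 4) * (s + 14) := by
  subst hm'
  have e0 : s + 13 - 4 = s + 9 := by omega
  have e1 : 2 * (s + 13) - 22 = 2 * s + 4 := by omega
  have e2 : s + 14 - 5 = s + 9 := by omega
  have e4 : s + 14 - 7 = s + 7 := by omega
  rw [e0, e1] at hS'
  rw [e4] at hT
  rw [e2]
  nlinarith [hS', hT]

/-- `d = 5`, mixed onto `(k − 1, 5, 4)`: `S' + 4 (k − 6) ≤ m' (k − 1)`, `T + (k − 7) ≤ 5 (k − 7) + 5`. -/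
theorem five_four_del_five_mixed_arith (s m' S' T : ℕ) (hm' : m' = 5 * s + 36)
    (hS' : S' + 4 * (s + 13 - 1 - 4) ≤ m' * (s + 13)) (hT : T + (s + 14 - 7) ≤ 5 * (s + 14 - 7) + 5) :
    S' + 2 * T + 5 + 5 * 5 + 4 * (s + 14 - 5) + 4 ≤ (m' + 5) * (s + 14) := by
  subst hm'
  have e1 : s + 13 - 1 - 4 = s + 8 := by omega
  have e2 : s + 14 - 5 = s + 9 := by omega
  have e4 : s + 14 - 7 = s + 7 := by omega
  rw [e1] at hS'
  rw [e4] at hT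
  rw [e2]
  nlinarith [hS', hT]

/-- `d = 5`, `D − z` not `5`-bipartite on `(k − 1, 5, 4)` at the induction hypothesis: `S' + 4 (k − 6) + 4 ≤ m' (k − 1)`,
`T ≤ 5 (k − 7)`. -/
theorem five_four_del_five_gap_arith (s m' S' T : ℕ) (hm' : m' = 5 * s + 36)
    (hS' : S' + 4 * (s + 13 - 5) + 4 ≤ m' * (s + 13)) (hT : T ≤ 5 * (s + 14 - 7)) :
    S' + 2 * T + 5 + 5 * 5 + 4 * (s + 14 - 5) + 4 ≤ (m' + 5) * (s + 14) := by
  subst hm'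
  have e0 : s + 13 - 5 = s + 8 := by omega
  have e2 : s + 14 - 5 = s + 9 := by omega
  have e4 : s + 14 - 7 = s + 7 := by omega
  rw [e0] at hS'
  rw [e4] at hT
  rw [e2]
  nlinarith [hS', hT]

end C047

end TriangleCap

end PercRepro
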